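import Mathlib

/-!
# Crux `TateFamilyKernel` (stmt-KontsevichZagierPeriods-9130), line `Sketch`: stub `stub_linMoments`

Step 1 (MOMENTS) of the linear class of the lead's skeleton of the crux
`Summit.KontsevichZagierPeriods.KontsevichZagierPeriods.Theses.InverseLandau.TateFamilyKernel`:
the Tate denominator `Q = 1 − ϖ(α + βz₂)z₁` (`0 < α`, `0 < β`; variables `X 0 = z₁`, `X 1 = z₂`,
`X (Fin.last 2) = ϖ`) with a `ϖ`-free numerator `P`. If `Q ≠ 0` on `[0,1]² × (0,b)` and the
open-square integrals `∫ P/Q(·,ϖ)` vanish for all `ϖ ∈ (0,b)`, then every moment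
`μ_M = ∫_{(0,1)²} P·((α+βz₂)z₁)^M` vanishes.

* Admissibility forces `ϖ(α+β) < 1` on `(0,b)`: otherwise `ϖ₁ = 1/(α+β) ∈ (0,b)` and `z = (1,1)`
  give `Q = 0` (`LinMoments.mul_lt_one_of_adm`).
* For such `ϖ`, `T(z) = (α+βz₂)z₁ ∈ [0, α+β]` on the square, so `P/Q = Σ_M P·(ϖT)^M` with the
  uniform domination `|P|·(ϖ(α+β))^M`; dominated convergence for series gives
  `∫ P/Q(·,ϖ) = Σ_M μ_M ϖ^M` (`LinMoments.hasSum_moments`), and `|μ_M| ≤ (∫|P|)(α+β)^M`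
  (`LinMoments.abs_moment_le`).
* A real power series with coefficients `|μ_M| ≤ C R^M` whose sum vanishes on `(0,b)` is zero:
  the sum of `FormalMultilinearSeries.ofScalars ℝ μ` is analytic at `0` (radius `≥ 1/R`) and
  vanishes frequently near `0`, hence identically near `0` (isolated zeros), hence the series is
  zero (`HasFPowerSeriesAt.locally_zero_iff`) — `LinMoments.eq_zero_of_hasSum_Ioo`.

Mathlib only; no named fact, no new definition.
-/

noncomputable section

open MeasureTheory Set MvPolynomial
open scoped Topology

namespace Summit.KontsevichZagierPeriods.InverseLandau.TateFamilyKernel.Descent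

namespace LinMoments

/-! ### Coefficients of a real power series vanishing on an interval `(0,b)` -/

/-- **Uniqueness of power-series coefficients from one side.** If `|μ_M| ≤ C R^M` (`0 < R`) and
`Σ_M μ_M ϖ^M = 0` for every `ϖ ∈ (0,b)` (`0 < b`), then `μ_M = 0` for all `M`: the sum of the
series is analytic at `0` and its zeros accumulate at `0`. [folklore] -/
theorem eq_zero_of_hasSum_Ioo {μ : ℕ → ℝ} {C R b : ℝ} (hR : 0 < R) (hb : 0 < b)
    (hμ : ∀ M, |μ M| ≤ C * R ^ M) (hsum : ∀ ϖ ∈ Ioo 0 b, HasSum (fun M => μ M * ϖ ^ M) 0)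
    (M : ℕ) : μ M = 0 := by
  set p : FormalMultilinearSeries ℝ ℝ ℝ := FormalMultilinearSeries.ofScalars ℝ μ with hp
  -- the radius of convergence is at least `1/R`
  have hrad : ((Real.toNNReal R⁻¹ : NNReal) : ENNReal) ≤ p.radius := by
    refine p.le_radius_of_bound C fun n => ?_
    rw [hp, FormalMultilinearSeries.ofScalars_norm, Real.coe_toNNReal _ (inv_nonneg.mpr hR.le),
      Real.norm_eq_abs]
    calc |μ n| * R⁻¹ ^ n ≤ C * R ^ n * R⁻¹ ^ n :=
          mul_le_mul_of_nonneg_right (hμ n) (pow_nonneg (inv_nonneg.mpr hR.le) n)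
      _ = C := by rw [mul_assoc, ← mul_pow, mul_inv_cancel₀ hR.ne', one_pow, mul_one]
  have hpos : 0 < p.radius := lt_of_lt_of_le (by simpa using hR) hrad
  have hps : HasFPowerSeriesOnBall p.sum p 0 p.radius := p.hasFPowerSeriesOnBall hpos
  -- the sum vanishes on `(0, min b R⁻¹)`
  have hzero : ∀ ϖ ∈ Ioo 0 (min b R⁻¹), p.sum ϖ = 0 := by
    intro ϖ hϖ
    have h1 : p.sum ϖ = ∑' n, μ n • ϖ ^ n := by
      rw [hp]
      exact FormalMultilinearSeries.ofScalars_sum_eq μ ϖ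
    rw [h1]
    simp_rw [smul_eq_mul]
    exact (hsum ϖ ⟨hϖ.1, lt_of_lt_of_le hϖ.2 (min_le_left _ _)⟩).tsum_eq
  have hfreq : ∃ᶠ z in 𝓝[≠] (0 : ℝ), p.sum z = 0 := by
    have hev : ∀ᶠ z in 𝓝[>] (0 : ℝ), p.sum z = 0 := by
      filter_upwards [Ioo_mem_nhdsGT (lt_min hb (inv_pos.mpr hR))] with z hz using hzero z hz
    exact hev.frequently.filter_mono (nhdsWithin_mono _ fun z hz => ne_of_gt hz)
  have hev : ∀ᶠ z in 𝓝 (0 : ℝ), p.sum z = 0 :=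
    hps.analyticAt.frequently_zero_iff_eventually_zero.mp hfreq
  have hp0 : p = 0 := hps.hasFPowerSeriesAt.locally_zero_iff.mp hev
  have hμ0 : μ = 0 := (FormalMultilinearSeries.ofScalars_series_eq_zero ℝ).mp (hp ▸ hp0)
  exact congrFun hμ0 M

/-! ### Evaluations -/

/-- The sliced `ϖ`-free numerator: `(rename castSucc P)(z, ϖ) = P(z)`. [folklore] -/
theorem aeval_snoc_rename_castSucc (P : MvPolynomial (Fin 2) ℚ) (z : Fin 2 → ℝ) (ϖ : ℝ) :
    aeval (Fin.snoc z ϖ : Fin (2 + 1) → ℝ) (rename Fin.castSucc P) = aeval z P := by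
  rw [aeval_rename, Fin.snoc_comp_castSucc]

/-- The linear denominator at `(z, ϖ)`: `Q(z, ϖ) = 1 − ϖ(α + βz₂)z₁`. [folklore] -/
theorem aeval_snoc_linDen (α β : ℚ) (z : Fin 2 → ℝ) (ϖ : ℝ) :
    aeval (Fin.snoc z ϖ : Fin (2 + 1) → ℝ)
        (1 - X (Fin.last 2) * (C α + C β * X 1) * X 0 : MvPolynomial (Fin (2 + 1)) ℚ) =
      1 - ϖ * (((α : ℝ) + β * z 1) * z 0) := by
  have h0 : (Fin.snoc z ϖ : Fin (2 + 1) → ℝ) 0 = z 0 := rfl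
  have h1 : (Fin.snoc z ϖ : Fin (2 + 1) → ℝ) 1 = z 1 := rfl
  simp only [map_sub, map_one, map_mul, map_add, aeval_X, aeval_C, Fin.snoc_last, h0, h1,
    eq_ratCast]
  ring

/-! ### The open square and the two polynomial functions `P`, `T = (α+βz₂)z₁` on it -/

/-- The open square `(0,1)²` is measurable. [folklore] -/
theorem measurableSet_sq :
    MeasurableSet (Set.pi Set.univ (fun _ : Fin 2 => Ioo (0 : ℝ) 1)) :=
  MeasurableSet.univ_pi fun _ => measurableSet_Ioo

/-- The open square lies in the closed square `Icc 0 1`. [folklore] -/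
theorem sq_subset_Icc :
    (Set.pi Set.univ (fun _ : Fin 2 => Ioo (0 : ℝ) 1)) ⊆ Icc (0 : Fin 2 → ℝ) 1 :=
  fun _ hz => ⟨fun i => ((mem_univ_pi.mp hz) i).1.le, fun i => ((mem_univ_pi.mp hz) i).2.le⟩

/-- Real evaluation of a `ℚ`-polynomial in two variables is continuous. [folklore] -/
theorem continuous_aeval (P : MvPolynomial (Fin 2) ℚ) :
    Continuous fun z : Fin 2 → ℝ => aeval z P := by
  have : (fun z : Fin 2 → ℝ => aeval z P) = fun z => eval z (map (algebraMap ℚ ℝ) P) := by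
    funext z
    rw [eval_map, aeval_def]
  rw [this]
  exact MvPolynomial.continuous_eval _

/-- A `ℚ`-polynomial is integrable on the open square. [folklore] -/
theorem integrableOn_aeval (P : MvPolynomial (Fin 2) ℚ) :
    IntegrableOn (fun z : Fin 2 → ℝ => aeval z P)
      (Set.pi Set.univ (fun _ : Fin 2 => Ioo (0 : ℝ) 1)) volume :=
  (continuous_aeval P).integrableOn_Icc.mono_set sq_subset_Icc

/-- On the open square, `0 ≤ (α+βz₂)z₁ ≤ α+β` (`0 < α`, `0 < β`). [folklore] -/
theorem T_bounds {α β : ℚ} (hα : 0 < α) (hβ : 0 < β) {z : Fin 2 → ℝ}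
    (hz : z ∈ Set.pi Set.univ (fun _ : Fin 2 => Ioo (0 : ℝ) 1)) :
    0 ≤ ((α : ℝ) + β * z 1) * z 0 ∧ ((α : ℝ) + β * z 1) * z 0 ≤ (α : ℝ) + β := by
  have h0 := (mem_univ_pi.mp hz) 0
  have h1 := (mem_univ_pi.mp hz) 1
  have hα' : (0 : ℝ) < α := by exact_mod_cast hα
  have hβ' : (0 : ℝ) < β := by exact_mod_cast hβ
  have hw : (0 : ℝ) ≤ (α : ℝ) + β * z 1 := (add_pos hα' (mul_pos hβ' h1.1)).le
  refine ⟨mul_nonneg hw h0.1.le, (mul_le_of_le_one_right hw h0.2.le).trans ?_⟩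
  have h2 := mul_le_of_le_one_right hβ'.le h1.2.le
  linarith

/-! ### Admissibility bounds the parameter interval -/

/-- **`b ≤ 1/(α+β)`**: if `Q = 1 − ϖ(α+βz₂)z₁` does not vanish on `[0,1]² × (0,b)`, then
`ϖ(α+β) < 1` for every `ϖ ∈ (0,b)` (otherwise `ϖ₁ = 1/(α+β) ∈ (0,b)` and the corner `z = (1,1)`
give `Q = 0`). [folklore] -/
theorem mul_lt_one_of_adm {α β : ℚ} {b : ℝ} (hα : 0 < α) (hβ : 0 < β)
    (hadm : ∀ (z : Fin 2 → ℝ) (ϖ : ℝ), (∀ t, z t ∈ Icc (0 : ℝ) 1) → ϖ ∈ Ioo 0 b →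
      aeval (Fin.snoc z ϖ : Fin (2 + 1) → ℝ)
        (1 - X (Fin.last 2) * (C α + C β * X 1) * X 0 : MvPolynomial (Fin (2 + 1)) ℚ) ≠ 0)
    {ϖ : ℝ} (hϖ : ϖ ∈ Ioo 0 b) : ϖ * ((α : ℝ) + β) < 1 := by
  have hαβ : (0 : ℝ) < (α : ℝ) + β := by exact_mod_cast add_pos hα hβ
  refine not_le.mp fun h => ?_
  have hle : 1 / ((α : ℝ) + β) ≤ ϖ := (div_le_iff₀ hαβ).mpr h
  have hϖ₁ : 1 / ((α : ℝ) + β) ∈ Ioo 0 b := ⟨one_div_pos.mpr hαβ, hle.trans_lt hϖ.2⟩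
  refine hadm (fun _ => 1) _ (fun _ => ⟨zero_le_one, le_rfl⟩) hϖ₁ ?_
  rw [aeval_snoc_linDen]
  simp only [mul_one]
  rw [one_div, inv_mul_cancel₀ hαβ.ne', sub_self]

/-! ### The power-series expansion of the fibre integral -/

/-- **Geometric bound on the moments**: `|∫_□ P·T^M| ≤ (∫_□ |P|)(α+β)^M`. [folklore] -/
theorem abs_moment_le {α β : ℚ} (hα : 0 < α) (hβ : 0 < β) (P : MvPolynomial (Fin 2) ℚ) (M : ℕ) :
    |∫ z in Set.pi Set.univ (fun _ : Fin 2 => Ioo (0 : ℝ) 1),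
        aeval z P * (((α : ℝ) + β * z 1) * z 0) ^ M| ≤
      (∫ z in Set.pi Set.univ (fun _ : Fin 2 => Ioo (0 : ℝ) 1), ‖aeval z P‖) *
        ((α : ℝ) + β) ^ M := by
  rw [← Real.norm_eq_abs, ← integral_mul_const]
  refine norm_integral_le_of_norm_le ((integrableOn_aeval P).norm.mul_const _) ?_
  refine ae_restrict_of_forall_mem measurableSet_sq fun z hz => ?_
  have hT := T_bounds hα hβ hz
  rw [norm_mul, norm_pow, Real.norm_of_nonneg hT.1]
  exact mul_le_mul_of_nonneg_left (pow_le_pow_left₀ hT.1 hT.2 M) (norm_nonneg _)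

/-- **Power-series expansion of the fibre integral.** For `0 ≤ ϖ` with `ϖ(α+β) < 1`,
`Σ_M (∫_□ P·T^M) ϖ^M = ∫_□ P/(1 − ϖT)`, `T = (α+βz₂)z₁`: on the square `0 ≤ ϖT ≤ ϖ(α+β) < 1`,
so `P/(1 − ϖT) = Σ_M P(ϖT)^M` pointwise with the summable uniform domination `|P|(ϖ(α+β))^M`,
and dominated convergence for series applies. [folklore] -/
theorem hasSum_moments {α β : ℚ} (hα : 0 < α) (hβ : 0 < β) (P : MvPolynomial (Fin 2) ℚ) {ϖ : ℝ}
    (hϖ0 : 0 ≤ ϖ) (hϖ1 : ϖ * ((α : ℝ) + β) < 1) :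
    HasSum (fun M : ℕ => (∫ z in Set.pi Set.univ (fun _ : Fin 2 => Ioo (0 : ℝ) 1),
        aeval z P * (((α : ℝ) + β * z 1) * z 0) ^ M) * ϖ ^ M)
      (∫ z in Set.pi Set.univ (fun _ : Fin 2 => Ioo (0 : ℝ) 1),
        aeval z P / (1 - ϖ * (((α : ℝ) + β * z 1) * z 0))) := by
  set q : ℝ := ϖ * ((α : ℝ) + β) with hq
  have hq0 : 0 ≤ q := mul_nonneg hϖ0 (by exact_mod_cast (add_pos hα hβ).le)
  simp_rw [← integral_mul_const]
  refine hasSum_integral_of_dominated_convergence (fun M z => ‖aeval z P‖ * q ^ M)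
    (fun M => ?_) (fun M => ?_) ?_ ?_ ?_
  · have hc : Continuous fun z : Fin 2 → ℝ => (((α : ℝ) + β * z 1) * z 0) ^ M := by fun_prop
    have hF : Continuous ((fun z : Fin 2 → ℝ => aeval z P) *
        (fun z : Fin 2 → ℝ => (((α : ℝ) + β * z 1) * z 0) ^ M) * fun _ => ϖ ^ M) :=
      ((continuous_aeval P).mul hc).mul continuous_const
    exact hF.aestronglyMeasurable
  · refine ae_restrict_of_forall_mem measurableSet_sq fun z hz => ?_
    have hT := T_bounds hα hβ hz
    rw [norm_mul, norm_mul, norm_pow, norm_pow, Real.norm_of_nonneg hT.1,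
      Real.norm_of_nonneg hϖ0, mul_assoc, ← mul_pow]
    refine mul_le_mul_of_nonneg_left (pow_le_pow_left₀ (mul_nonneg hT.1 hϖ0) ?_ M)
      (norm_nonneg _)
    calc ((α : ℝ) + β * z 1) * z 0 * ϖ ≤ ((α : ℝ) + β) * ϖ := mul_le_mul_of_nonneg_right hT.2 hϖ0
      _ = q := by rw [hq]; ring
  · exact Filter.Eventually.of_forall fun z =>
      (summable_geometric_of_lt_one hq0 hϖ1).mul_left _
  · simp_rw [tsum_mul_left, tsum_geometric_of_lt_one hq0 hϖ1]
    exact (integrableOn_aeval P).norm.mul_const _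
  · refine ae_restrict_of_forall_mem measurableSet_sq fun z hz => ?_
    have hT := T_bounds hα hβ hz
    have hr1 : ϖ * (((α : ℝ) + β * z 1) * z 0) < 1 :=
      lt_of_le_of_lt (mul_le_mul_of_nonneg_left hT.2 hϖ0) hϖ1
    have h := (hasSum_geometric_of_lt_one (mul_nonneg hϖ0 hT.1) hr1).mul_left (aeval z P)
    have hfun : (fun n : ℕ => aeval z P * (((α : ℝ) + β * z 1) * z 0) ^ n * ϖ ^ n) =
        fun n : ℕ => aeval z P * (ϖ * (((α : ℝ) + β * z 1) * z 0)) ^ n := by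
      funext n
      rw [mul_pow ϖ]
      ring
    rw [hfun, div_eq_mul_inv]
    exact h

end LinMoments

/-- STUB `stub_linMoments` (linear class, step 1: MOMENTS). For `Q = 1 − ϖ(α + βz₂)z₁`
(`0 < α`, `0 < β`) non-vanishing on `[0,1]² × (0,b)` and a `ϖ`-free numerator `P` whose
open-square fibre integrals `∫_{(0,1)²} P/Q(·,ϖ)` vanish for all `ϖ ∈ (0,b)`, every moment
`∫_{(0,1)²} P·((α+βz₂)z₁)^M` vanishes: admissibility gives `ϖ(α+β) < 1` on `(0,b)`
(`LinMoments.mul_lt_one_of_adm`), the geometric series and dominated convergence expand the fibre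
integral as the power series `Σ_M μ_M ϖ^M` with `|μ_M| ≤ (∫|P|)(α+β)^M`
(`LinMoments.hasSum_moments`, `LinMoments.abs_moment_le`), and a real power series vanishing on
`(0,b)` has all coefficients zero (`LinMoments.eq_zero_of_hasSum_Ioo`, isolated zeros).
[cite: KontsevichZagier2001, §1.2] -/
theorem stub_linMoments (α β : ℚ) (P : MvPolynomial (Fin 2) ℚ) (b : ℝ) (hα : 0 < α) (hβ : 0 < β)
    (hb : 0 < b)
    (hadm : ∀ (z : Fin 2 → ℝ) (ϖ : ℝ), (∀ t, z t ∈ Icc (0 : ℝ) 1) → ϖ ∈ Ioo 0 b →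
      aeval (Fin.snoc z ϖ : Fin (2 + 1) → ℝ)
        (1 - X (Fin.last 2) * (C α + C β * X 1) * X 0 : MvPolynomial (Fin (2 + 1)) ℚ) ≠ 0)
    (hvan : ∀ ϖ ∈ Ioo 0 b, ∫ z in Set.pi Set.univ (fun _ : Fin 2 => Ioo (0 : ℝ) 1),
      aeval (Fin.snoc z ϖ : Fin (2 + 1) → ℝ) (rename Fin.castSucc P) /
        aeval (Fin.snoc z ϖ : Fin (2 + 1) → ℝ)
          (1 - X (Fin.last 2) * (C α + C β * X 1) * X 0 : MvPolynomial (Fin (2 + 1)) ℚ) = 0) :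
    ∀ M : ℕ, ∫ z in Set.pi Set.univ (fun _ : Fin 2 => Ioo (0 : ℝ) 1),
      aeval z P * (((α : ℝ) + β * z 1) * z 0) ^ M = 0 := by
  have hαβ : (0 : ℝ) < (α : ℝ) + β := by exact_mod_cast add_pos hα hβ
  refine LinMoments.eq_zero_of_hasSum_Ioo hαβ hb (fun M => LinMoments.abs_moment_le hα hβ P M)
    fun ϖ hϖ => ?_
  have h := LinMoments.hasSum_moments hα hβ P hϖ.1.le (LinMoments.mul_lt_one_of_adm hα hβ hadm hϖ)
  have h0 := hvan ϖ hϖ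
  simp only [LinMoments.aeval_snoc_rename_castSucc, LinMoments.aeval_snoc_linDen] at h0
  rwa [h0] at h

end Summit.KontsevichZagierPeriods.InverseLandau.TateFamilyKernel.Descent
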